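import Summits.NavierStokesRegularity.NavierStokesRegularity.Theses.AxisymmetricExtremality
import Summits.NavierStokesRegularity.NavierStokesRegularity.Theorems.AxisymmetricExtremalityAxisymmetricKatoGlobalStubSereginLogSwirlOriginCoreNormaliseRescale
import Summits.NavierStokesRegularity.NavierStokesRegularity.Theorems.AxisymmetricExtremalityAxisymmetricKatoGlobalStubSereginLogSwirlOriginStep1CutoffChain
import Summits.NavierStokesRegularity.NavierStokesRegularity.Theorems.AxisymmetricExtremalityAxisymmetricKatoGlobalStubSereginLogSwirlOriginStep1CutoffCompact
import Summits.NavierStokesRegularity.NavierStokesRegularity.Theorems.AxisymmetricExtremalityAxisymmetricKatoGlobalStubSereginLogSwirlOriginStep3LocalKeyEstimate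
import HarnessLib

/-!
# Seregin 2022, §2: bridges for the cut-off globalisation `v = χW` of the Seregin–Zajaczkowski
# representative (inputs of the Step 1 + 3 + 4 chain for the class of the fact's core) —
# crux stmt-NavierStokesRegularity-15453 (`AxisymmetricExtremality.AxisymmetricKatoGlobal`), line registered, support for stub `stub_sereginLogSwirlOrigin`

Support file (`--supports stmt-NavierStokesRegularity-15453`; theorems only, everything proved)
toward the registered stub `stub_sereginLogSwirlOrigin` = the named fact
`Literature.Analysis.FluidPDE.seregin2022_logSwirl_regularAtOrigin` (G. Seregin, J. Math. Fluid
Mech. 24 (2022), Paper 27 = arXiv:2201.00153, §2: Def. 1.1 in `Q = 𝒞 × ]-1, 0[` + axial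
symmetry + the swirl bound (2.2) ⇒ the origin is a regular point).

The sibling `…CoreNormalise` (p170530) reduced the fact to the CORE AT THE ORIGIN
(`seregin2022_logSwirl_regularAtOrigin_of_coreAtOrigin`: Steps 2–4 at `ẑ = 0`, `R = 1` for the
Seregin–Zajaczkowski representative `W` of `u` on `Q`), the sibling `…Step1CutoffChain`
(p170786, `tendsto_cubicC_of_classical_cleanConfig`) ran Steps 1 + 3 + 4 end to end for the
CLASSICAL class, and the local port of the Step-3 key estimate has landed
(`…Step3LocalKeyEstimateSZ`, p171742, `cutoff_energy_keyEstimate_of_isSmoothAxisymmetricSolutionOn`,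
stated for the cut-off globalisation `v = χW`, `χ = 1` on `𝒞(ρ₀)`, `tsupport χ ⊆ 𝒞(ρ₁)`,
`cutoffFamily_package`).  Re-running the chain for `v = χW` needs the following bridges between
the data of `W` on `Q` and the (global) hypotheses of the chain for `v`, proved here:

* `swirl_cutoffField`, `swirlBound_cutoffField` — `σ(χW) = χσ(W)`, hence **(2.2) for `v`
  GLOBALLY off the axis** from (2.2) for `W` on `Q` off the axis (`0 ≤ χ ≤ 1`, `χ = 0` off `𝒞`;
  the key estimate asks the swirl bound at every `x` with `0 < ϱ(x) < r₁`, all `x₃`);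
* `energyBound_cutoffField` — `∫_𝒞 |v(t)|² ≤ ∫_𝒞 |W(t)|² ≤ A`;
* `cutoffField_eq_of_mem`, `cubicC_cutoffField` — `v = W` on `𝒞(ρ₀)`, so
  `C(R; v) = C(R; W)` for `R ≤ ρ₀` (`SereginSverak2009.cubicC`);
* `aestronglyMeasurable_cutoffField` — measurability of `v` on `Q(r)`, `r ≤ min ρ₀ 1`
  (`aestronglyMeasurable_repr`);
* `derivBounds_of_eventuallyEq` — the bounds `‖W‖ ≤ D₀`, `‖DW‖ ≤ D₁`, `‖D²W‖ ≤ D₂` at a point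
  near which `v t = W t` pass to `v` (the regular region `K` of Step 1 lies in `𝒞(ρ₀)`);
* `continuousOn_dissipation_cutoffField` — **continuity in time of the two dissipation densities**
  `s ↦ ∫ Σᵢ(∂ᵢ(ζΓ(s)))²`, `s ↦ ∫ Σᵢ(∂ᵢ(ζΦ(s)))²` (`Γ = angVortQuot (v s)`, `Φ = radVelQuot (curl (v s))`)
  on the open time set, the Step-4 input `hDΓc`/`hDΦc` of `tendsto_cubicC_of_keyEstimate`, from
  the uniform-in-`x` time moduli of `cutoffFamily_package` (`continuousOn_quotient_families`,
  `continuousOn_integral_gradSq_cutoff_of_continuousOn`) — replacing the joint space-time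
  smoothness used by the classical chain, which the local class lacks.

## Mathlib / tree search

Tree: `continuousOn_quotient_families` (`…Step3LocalKeyEstimate`),
`continuousOn_integral_gradSq_cutoff_of_continuousOn` (`…Step3LocalApriori`),
`aestronglyMeasurable_repr`, `parCyl_zero_one_eq_prod` (`…Step1CutoffCompact`),
`one_le_log_exp_div` (`…Step1CutoffChain`), `mem_spaceCyl_zero_iff` (`…CoreNormaliseRescale`),
`contDiff_angVortQuot`, `contDiff_radVelQuot`, `contDiff_curl_of_succ`, `swirl`.
Mathlib: `Filter.EventuallyEq.fderiv_eq/.iteratedFDeriv`, `AEStronglyMeasurable.congr`,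
`setLIntegral_congr_fun`, `ofReal_norm`, `image_eq_zero_of_notMem_tsupport`.
`lean search 'cutoffField_eq_of_mem|swirlBound_cutoffField|dissipation_cutoffField' --decl`:
no matches (2026-08-17).

## References

* G. Seregin, J. Math. Fluid Mech. 24 (2022), Paper No. 27 = arXiv:2201.00153, §2 proof of
  Thm. 1.2, Steps 1, 3, 4 (arXiv pp. 5–7). [`Seregin2022LocalAxisym`]
* G. Seregin, W. Zajaczkowski, SIAM J. Math. Anal. 39 (2007) 669–685, Prop. 4.1 (the class).
  [`SereginZajaczkowski2007`]
-/

noncomputable section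

open Set Filter Topology Function Metric MeasureTheory intervalIntegral
open scoped ENNReal NNReal ContDiff
open Literature.Analysis.FluidPDE Literature.Analysis.FluidPDE.SereginZajaczkowski2007

-- `<Problem> = <Summit>` duplicates a namespace component by design (lakefile sets the same option).
set_option linter.dupNamespace false

namespace Summit.NavierStokesRegularity.NavierStokesRegularity.Theorems.AxisymmetricKatoGlobal.EulerScaling

/-! ### Bridges for the cut-off globalisation `v = χW` -/

section Bridges

variable {W v : ℝ → EuclideanSpace ℝ (Fin 3) → EuclideanSpace ℝ (Fin 3)} {χ : EuclideanSpace ℝ (Fin 3) → ℝ}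

/-- `σ(χW) = χ σ(W)` (the swirl is linear in the field). [folklore] -/
theorem swirl_cutoffField (hv : ∀ t, v t = fun y => χ y • W t y) (t : ℝ) (x : EuclideanSpace ℝ (Fin 3)) :
    swirl (v t) x = χ x * swirl (W t) x := by
  rw [hv]
  simp only [swirl, PiLp.smul_apply, smul_eq_mul]
  ring

/-- **(2.2) for `v = χW`, globally off the axis**: if `|σ(W)| ≤ C₁/ln³(e/ϱ)` on `Q` off the axis,
`0 ≤ χ ≤ 1`, `tsupport χ ⊆ 𝒞`, `C₁ ≥ 0`, then `|σ(v t)(x)| ≤ C₁/ln³(e/ϱ(x))` for `t ∈ ]-1, 0[` and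
EVERY `x` with `0 < ϱ(x) < 1` (off `𝒞` the field vanishes and the bound is nonnegative).
[cite: Seregin2022LocalAxisym, §2 Step 1 (arXiv:2201.00153 p. 5), "we may assume also that (2.2) holds in 𝒞"] -/
theorem swirlBound_cutoffField (hv : ∀ t, v t = fun y => χ y • W t y)
    (hχ01 : ∀ y, 0 ≤ χ y ∧ χ y ≤ 1)
    (hχs : tsupport χ ⊆ SereginSverak2009.spaceCyl (0 : EuclideanSpace ℝ (Fin 3)) 1) {C₁ : ℝ} (hC₁ : 0 ≤ C₁)
    (hσ : ∀ z ∈ SereginSverak2009.parCyl (0 : ℝ × EuclideanSpace ℝ (Fin 3)) 1, 0 < cylRadius z.2 →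
      |swirl (W z.1) z.2| ≤ C₁ / Real.log (Real.exp 1 / cylRadius z.2) ^ 3) :
    ∀ t ∈ Ioo (-1 : ℝ) 0, ∀ x : EuclideanSpace ℝ (Fin 3), 0 < cylRadius x → cylRadius x < 1 →
      |swirl (v t) x| ≤ C₁ / Real.log (Real.exp 1 / cylRadius x) ^ 3 := by
  intro t ht x hx0 hx1
  have hRHS : 0 ≤ C₁ / Real.log (Real.exp 1 / cylRadius x) ^ 3 :=
    div_nonneg hC₁ (pow_nonneg (zero_le_one.trans (one_le_log_exp_div hx0 hx1.le)) 3)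
  rw [swirl_cutoffField hv]
  by_cases hχx : χ x = 0
  · rw [hχx, zero_mul, abs_zero]; exact hRHS
  · have hxs : x ∈ SereginSverak2009.spaceCyl (0 : EuclideanSpace ℝ (Fin 3)) 1 :=
      hχs (subset_tsupport _ (mem_support.2 hχx))
    have hz : ((t, x) : ℝ × EuclideanSpace ℝ (Fin 3)) ∈ SereginSverak2009.parCyl (0 : ℝ × EuclideanSpace ℝ (Fin 3)) 1 := by
      rw [parCyl_zero_one_eq_prod]; exact ⟨ht, hxs⟩
    rw [abs_mul, abs_of_nonneg (hχ01 x).1]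
    calc χ x * |swirl (W t) x| ≤ 1 * |swirl (W t) x| :=
        mul_le_mul_of_nonneg_right (hχ01 x).2 (abs_nonneg _)
      _ ≤ C₁ / Real.log (Real.exp 1 / cylRadius x) ^ 3 := by rw [one_mul]; exact hσ (t, x) hz hx0

/-- `‖χ W‖ₑ² ≤ ‖W‖ₑ²` for `0 ≤ χ ≤ 1`, hence the energy bound passes to `v = χW`. [folklore] -/
theorem energyBound_cutoffField (hv : ∀ t, v t = fun y => χ y • W t y)
    (hχ01 : ∀ y, 0 ≤ χ y ∧ χ y ≤ 1) {A : ℝ≥0} {t : ℝ}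
    (hA : ∫⁻ x in SereginSverak2009.spaceCyl (0 : EuclideanSpace ℝ (Fin 3)) 1, ‖W t x‖ₑ ^ 2 ≤ A) :
    ∫⁻ x in SereginSverak2009.spaceCyl (0 : EuclideanSpace ℝ (Fin 3)) 1, ‖v t x‖ₑ ^ 2 ≤ A := by
  refine (lintegral_mono fun x => ?_).trans hA
  have h : ‖v t x‖ ≤ ‖W t x‖ := by
    rw [hv]
    show ‖χ x • W t x‖ ≤ ‖W t x‖
    rw [norm_smul, Real.norm_of_nonneg (hχ01 x).1]
    exact mul_le_of_le_one_left (norm_nonneg _) (hχ01 x).2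
  have h' : ‖v t x‖ₑ ≤ ‖W t x‖ₑ := by
    rw [← ofReal_norm, ← ofReal_norm]
    exact ENNReal.ofReal_le_ofReal h
  gcongr

/-- On `𝒞(ρ₀)` (where `χ = 1`) the cut-off field is the field. [folklore] -/
theorem cutoffField_eq_of_mem (hv : ∀ t, v t = fun y => χ y • W t y) {ρ₀ : ℝ}
    (hχ1 : ∀ y ∈ SereginSverak2009.spaceCyl (0 : EuclideanSpace ℝ (Fin 3)) ρ₀, χ y = 1) (t : ℝ)
    {x : EuclideanSpace ℝ (Fin 3)} (hx : x ∈ SereginSverak2009.spaceCyl (0 : EuclideanSpace ℝ (Fin 3)) ρ₀) :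
    v t x = W t x := by
  rw [hv]
  show χ x • W t x = W t x
  rw [hχ1 x hx, one_smul]

/-- `C(R)` of the cut-off field is that of the field for `0 ≤ R ≤ ρ₀` (`v = W` on `Q(R) ⊆ ]-R², 0[ × 𝒞(ρ₀)`).
[folklore] -/
theorem cubicC_cutoffField (hv : ∀ t, v t = fun y => χ y • W t y) {ρ₀ : ℝ}
    (hχ1 : ∀ y ∈ SereginSverak2009.spaceCyl (0 : EuclideanSpace ℝ (Fin 3)) ρ₀, χ y = 1) {R : ℝ}
    (hR : R ≤ ρ₀) :
    SereginSverak2009.cubicC 0 R v = SereginSverak2009.cubicC 0 R W := by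
  unfold SereginSverak2009.cubicC
  congr 1
  refine setLIntegral_congr_fun (SereginSverak2009.isOpen_parCyl 0 R).measurableSet fun z hz => ?_
  have hz' := SereginSverak2009.mem_parCyl_zero.1 hz
  have hx : z.2 ∈ SereginSverak2009.spaceCyl (0 : EuclideanSpace ℝ (Fin 3)) ρ₀ :=
    mem_spaceCyl_zero_iff.2 ⟨hz'.2.1.trans_le hR, hz'.2.2.trans_le hR⟩
  simp only [cutoffField_eq_of_mem hv hχ1 z.1 hx]

/-- Measurability of the cut-off field on `Q(r)`, `0 ≤ r ≤ min ρ₀ 1`, from that of the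
representative (`aestronglyMeasurable_repr`; `v = W` on `Q(r)`). [folklore] -/
theorem aestronglyMeasurable_cutoffField {π : ℝ → EuclideanSpace ℝ (Fin 3) → ℝ}
    (hW : IsSmoothAxisymmetricSolutionOn (SereginSverak2009.parCylOpens 0 1) W π)
    (hv : ∀ t, v t = fun y => χ y • W t y) {ρ₀ : ℝ}
    (hχ1 : ∀ y ∈ SereginSverak2009.spaceCyl (0 : EuclideanSpace ℝ (Fin 3)) ρ₀, χ y = 1) {r : ℝ}
    (hr : 0 ≤ r) (hr1 : r ≤ 1) (hrρ : r ≤ ρ₀) :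
    AEStronglyMeasurable (uncurry v) (volume.restrict (SereginSverak2009.parCyl (0 : ℝ × EuclideanSpace ℝ (Fin 3)) r)) := by
  refine (aestronglyMeasurable_repr hW hr hr1).congr ?_
  refine (ae_restrict_iff' (SereginSverak2009.isOpen_parCyl 0 r).measurableSet).2 (ae_of_all _ fun z hz => ?_)
  have hz' := SereginSverak2009.mem_parCyl_zero.1 hz
  have hx : z.2 ∈ SereginSverak2009.spaceCyl (0 : EuclideanSpace ℝ (Fin 3)) ρ₀ :=
    mem_spaceCyl_zero_iff.2 ⟨hz'.2.1.trans_le hrρ, hz'.2.2.trans_le hrρ⟩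
  show W z.1 z.2 = v z.1 z.2
  rw [cutoffField_eq_of_mem hv hχ1 z.1 hx]

/-- **Derivative bounds near a point pass to the cut-off field** where `v t = W t` near `x`.
[folklore] -/
theorem derivBounds_of_eventuallyEq {t : ℝ} {x : EuclideanSpace ℝ (Fin 3)} (he : v t =ᶠ[𝓝 x] W t)
    {D₀ D₁ D₂ : ℝ} (h : ‖W t x‖ ≤ D₀ ∧ ‖fderiv ℝ (W t) x‖ ≤ D₁ ∧ ‖iteratedFDeriv ℝ 2 (W t) x‖ ≤ D₂) :
    ‖v t x‖ ≤ D₀ ∧ ‖fderiv ℝ (v t) x‖ ≤ D₁ ∧ ‖iteratedFDeriv ℝ 2 (v t) x‖ ≤ D₂ := by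
  refine ⟨?_, ?_, ?_⟩
  · rw [he.eq_of_nhds]; exact h.1
  · rw [he.fderiv_eq]; exact h.2.1
  · rw [(he.iteratedFDeriv ℝ 2).eq_of_nhds]; exact h.2.2

/-- **Continuity in time of the two dissipation densities of the cut-off field** on the open time
set `I`, from the uniform time moduli of `cutoffFamily_package` (`continuousOn_quotient_families`)
and `continuousOn_integral_gradSq_cutoff_of_continuousOn`, for a time-independent smooth
compactly supported cut-off `ζ`. [folklore] -/
theorem continuousOn_dissipation_cutoffField {I : Set ℝ} (hI : IsOpen I)
    (hsm : ∀ t ∈ I, ContDiff ℝ (⊤ : ℕ∞) (v t)) (hR : ∀ t ∈ I, ∀ y, 2 < ‖y‖ → v t y = 0)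
    (hU : ∀ k : ℕ, ∀ t ∈ I, ∀ ε > 0, ∃ δ > 0, ∀ t' ∈ I, |t' - t| < δ → ∀ y,
      ‖iteratedFDeriv ℝ k (v t') y - iteratedFDeriv ℝ k (v t) y‖ ≤ ε)
    {ζ : EuclideanSpace ℝ (Fin 3) → ℝ} (hζ : ContDiff ℝ (⊤ : ℕ∞) ζ) (hζc : HasCompactSupport ζ) :
    ContinuousOn (fun s => ∫ x, (fderiv ℝ (fun y => ζ y * angVortQuot (v s) y) x (EuclideanSpace.single 0 1) ^ 2 +
        fderiv ℝ (fun y => ζ y * angVortQuot (v s) y) x (EuclideanSpace.single 1 1) ^ 2 +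
        fderiv ℝ (fun y => ζ y * angVortQuot (v s) y) x (EuclideanSpace.single 2 1) ^ 2)) I ∧
    ContinuousOn (fun s => ∫ x, (fderiv ℝ (fun y => ζ y * radVelQuot (curl (v s)) y) x (EuclideanSpace.single 0 1) ^ 2 +
        fderiv ℝ (fun y => ζ y * radVelQuot (curl (v s)) y) x (EuclideanSpace.single 1 1) ^ 2 +
        fderiv ℝ (fun y => ζ y * radVelQuot (curl (v s)) y) x (EuclideanSpace.single 2 1) ^ 2)) I := by
  obtain ⟨hΓc, -, hDΓc, hΦc, -, hDΦc⟩ := continuousOn_quotient_families (S := I) (ν := (1 : ℝ)) hsm hR hU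
  have hζst : IsSmoothSpaceTimeOn I (fun _ : ℝ => ζ) := (hζ.comp contDiff_snd).contDiffOn
  have hsupp0 : ∀ t ∈ I, ∀ x ∉ tsupport ζ, (fun _ : ℝ => ζ) t x = 0 := fun t _ x hx =>
    image_eq_zero_of_notMem_tsupport hx
  have h4 : ∀ t ∈ I, ContDiff ℝ 4 (v t) := fun t ht => (hsm t ht).of_le (by norm_cast)
  have hΓd : ∀ t ∈ I, Differentiable ℝ fun x => angVortQuot (v t) x := fun t ht =>
    (contDiff_angVortQuot (n := 1) (by exact_mod_cast h4 t ht)).differentiable one_ne_zero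
  have hΦd : ∀ t ∈ I, Differentiable ℝ fun x => radVelQuot (curl (v t)) x := fun t ht =>
    (contDiff_radVelQuot (n := 1) (by exact_mod_cast
      (contDiff_curl_of_succ (n := 3) (by exact_mod_cast h4 t ht)))).differentiable one_ne_zero
  exact ⟨continuousOn_integral_gradSq_cutoff_of_continuousOn (G := fun t x => angVortQuot (v t) x) hI hζst hζc
      hsupp0 hΓc hΓd hDΓc,
    continuousOn_integral_gradSq_cutoff_of_continuousOn (G := fun t x => radVelQuot (curl (v t)) x) hI hζst hζc
      hsupp0 hΦc hΦd hDΦc⟩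

end Bridges

end Summit.NavierStokesRegularity.NavierStokesRegularity.Theorems.AxisymmetricKatoGlobal.EulerScaling

end
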